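import Mathlib
import HarnessLib
import Summits.ValiantsHypothesis.ValiantsHypothesis.Theorems.LacunarySymmetroidMatrixDescartesOsculationLawPeelBranchArcCalculus
import Summits.ValiantsHypothesis.ValiantsHypothesis.Theorems.LacunarySymmetroidMatrixDescartesOsculationLawPeelRankTwoEvents

/-!
# ValiantsHypothesis / LacunarySymmetroid — crux `MatrixDescartes` (stmt-ValiantsHypothesis-18050, V1),
# line `Cruxes/MatrixDescartes/Lines/osculation_law.lean` («osculation-law»), stub `stub_peel` (ALL ranks):
# HYPERBOLIC FAMILIES NEVER FOLD — BRANCHES ARE SIMPLE IN THE OPEN QUADRANT (rank-free)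

The general-rank replacement of the rank-two `OsculationPeel.no_fold` / `false_of_double_root`
(`…PeelRankTwoEvents`).  A spectral curve `Φ ∈ ℝ[X₀, X₁]` is presented through its vertical family
`P : ℝ → ℝ[X]`, `(P t)(b) = Φ(t, b)`; HYPERBOLICITY = `P t` splits over `ℝ` for every `t > 0` (for block pencils of
symmetric matrices this is `OsculationLetter.splits_det_add_X_smul_blockProj`, every rank, every degeneracy).

* `laguerre_prod`, `laguerre_nonneg` — LAGUERRE'S INEQUALITY `p·p'' ≤ (p')²` on `ℝ` for a real-rooted `p`
  (`(p')² − p·p'' = lc² Σ_i Π_{j ≠ i} (b − b_j)²`, by induction on the roots).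
* `eval_pderiv_one_eq_derivative`, `eval_pderiv_one_one_eq` — `∂_bΦ`, `∂_b²Φ` are the `b`-derivatives of `P t`.
* `eval_logHessian_eq_zero_of_flex` — `∂_bΦ = ∂_b²Φ = 0 ⇒ H(Φ) = 0` (companion of `…_of_singular`).
* `no_fold_hyperbolic` — at an exactly-double root `(t₀, b₀)`, `t₀ > 0`, of a hyperbolic family, `∂_tΦ = 0`:
  `F(t) = ∂_bΦ(t,b₀)² − Φ(t,b₀)·∂_b²Φ(t,b₀) ≥ 0` (Laguerre) vanishes at `t₀`, so `F'(t₀) = −∂_tΦ·∂_b²Φ = 0`.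
* `not_finite_of_vanishing_fibre` — `Φ(t₀,·) ≡ 0` for a `t₀ > 0` makes the osculation set infinite (rank-free
  `not_finite_of_vertical_ray`); `rootMultiplicity_le_one_of_finite` — the finite-osculation form of the next.
* **`rootMultiplicity_le_one_of_hyperbolic`** — under the line's general position «`∂_bΦ ≠ 0` on the osculation
  set», EVERY root `b₀ > 0` of `P t₀` (`t₀ > 0`, `P t₀ ≢ 0`) IS SIMPLE: a double root is a singular point
  (`no_fold_hyperbolic`) and a root of multiplicity `≥ 3` is a flex, either way `H(Φ) = 0` there, i.e. the point is
  an osculation point with `∂_bΦ = 0` — excluded.  Consequence for the general peel: in the open quadrant the `r`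
  real branches of a hyperbolic letter never collide, so they are globally ordered smooth functions wherever finite.

Honest framing: a rank-free LEMMA toward the OPEN stub `stub_peel` (all `r`); only its `r ≤ 2` instances are
theorems (`peelInequality_rankOne`, `peelInequality_rankTwo`); the LAW, `MatrixDescartes`, Conjecture B and
`VP ≠ VNP` are NOT proved.  No definitions, no named facts.
-/

-- `Summit.ValiantsHypothesis.ValiantsHypothesis.…` is the tree's mandated single-conjunct layout (Sub = Summit).
set_option linter.dupNamespace false

noncomputable section

namespace Summit.ValiantsHypothesis.ValiantsHypothesis.Theorems.LacunarySymmetroidMatrixDescartes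

open Polynomial Set
open MvPolynomial (pderiv)
open scoped BigOperators Topology

namespace OsculationPeel

/-! ### Laguerre's inequality for real-rooted polynomials -/

/-- For `q = Π_{a ∈ M} (X − a)`: `q(b)·q''(b) ≤ q'(b)²` for every real `b`. [folklore] -/
theorem laguerre_prod (M : Multiset ℝ) (b : ℝ) :
    ((M.map (fun a => X - Polynomial.C a)).prod).eval b
        * (derivative (derivative (M.map (fun a => X - Polynomial.C a)).prod)).eval b ≤
      (derivative (M.map (fun a => X - Polynomial.C a)).prod).eval b ^ 2 := by
  induction M using Multiset.induction_on with
  | empty => simp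
  | cons a M ih =>
    simp only [Multiset.map_cons, Multiset.prod_cons, Polynomial.derivative_mul, Polynomial.derivative_X_sub_C,
      one_mul, Polynomial.derivative_add, Polynomial.eval_add, Polynomial.eval_mul, Polynomial.eval_sub,
      Polynomial.eval_X, Polynomial.eval_C]
    nlinarith [ih, sq_nonneg (b - a), sq_nonneg (((M.map (fun a => X - Polynomial.C a)).prod).eval b),
      mul_nonneg (sq_nonneg (b - a)) (sub_nonneg.2 ih)]

/-- **Laguerre's inequality**: a real-rooted real polynomial satisfies `p(b)·p''(b) ≤ p'(b)²` on `ℝ`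
(`(p')² − p·p'' = lc² Σ_i Π_{j≠i}(b − b_j)² ≥ 0`). [folklore] -/
theorem laguerre_nonneg (p : ℝ[X]) (hp : p.Splits) (b : ℝ) :
    p.eval b * (derivative (derivative p)).eval b ≤ (derivative p).eval b ^ 2 := by
  have key := mul_le_mul_of_nonneg_left (laguerre_prod p.roots b) (sq_nonneg p.leadingCoeff)
  rw [hp.eq_prod_roots]
  simp only [Polynomial.derivative_C_mul, Polynomial.eval_mul, Polynomial.eval_C]
  nlinarith [key]

/-! ### The vertical family `P t = Φ(t, ·)` -/

/-- `∂_bΦ(t, b) = (P t)'(b)` when `(P t)(b) = Φ(t, b)` identically. [folklore] -/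
theorem eval_pderiv_one_eq_derivative (Φ : MvPolynomial (Fin 2) ℝ) (P : ℝ → ℝ[X])
    (hP : ∀ t b, (P t).eval b = MvPolynomial.eval ![t, b] Φ) (t b : ℝ) :
    MvPolynomial.eval ![t, b] (pderiv 1 Φ) = (derivative (P t)).eval b := by
  have h1 : HasDerivAt (fun s => (P t).eval s) ((derivative (P t)).eval b) b := Polynomial.hasDerivAt _ _
  have h2 := hasDerivAt_mvPolynomial_eval Φ (hasDerivAt_const b t) (hasDerivAt_id b)
  have hfun : (fun s => (P t).eval s) = fun s => MvPolynomial.eval ![t, s] Φ := funext fun s => hP t s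
  rw [hfun] at h1
  have := h2.unique h1
  simpa using this

/-- `∂_b²Φ(t, b) = (P t)''(b)`. [folklore] -/
theorem eval_pderiv_one_one_eq (Φ : MvPolynomial (Fin 2) ℝ) (P : ℝ → ℝ[X])
    (hP : ∀ t b, (P t).eval b = MvPolynomial.eval ![t, b] Φ) (t b : ℝ) :
    MvPolynomial.eval ![t, b] (pderiv 1 (pderiv 1 Φ)) = (derivative (derivative (P t))).eval b :=
  eval_pderiv_one_eq_derivative (pderiv 1 Φ) (fun t => derivative (P t))
    (fun t b => (eval_pderiv_one_eq_derivative Φ P hP t b).symm) t b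

/-- `d/dt Ψ(t, b₀) = ∂_tΨ(t, b₀)`. [folklore] -/
theorem hasDerivAt_eval_horizontal (Ψ : MvPolynomial (Fin 2) ℝ) (t b₀ : ℝ) :
    HasDerivAt (fun s => MvPolynomial.eval ![s, b₀] Ψ) (MvPolynomial.eval ![t, b₀] (pderiv 0 Ψ)) t := by
  have h := hasDerivAt_mvPolynomial_eval Ψ (hasDerivAt_id t) (hasDerivAt_const t b₀)
  simpa using h

/-- A flex in `b` kills the logarithmic Hessian: `∂_bΦ(p) = ∂_b²Φ(p) = 0 ⇒ H(Φ)(p) = 0`. [folklore] -/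
theorem eval_logHessian_eq_zero_of_flex (Φ : MvPolynomial (Fin 2) ℝ) (p : Fin 2 → ℝ)
    (h1 : MvPolynomial.eval p (MvPolynomial.pderiv 1 Φ) = 0)
    (h11 : MvPolynomial.eval p (MvPolynomial.pderiv 1 (MvPolynomial.pderiv 1 Φ)) = 0) :
    MvPolynomial.eval p
        (MvPolynomial.X 0 * MvPolynomial.pderiv 0 (MvPolynomial.X 0 * MvPolynomial.pderiv 0 Φ)
            * (MvPolynomial.X 1 * MvPolynomial.pderiv 1 Φ) ^ 2
          - 2 * (MvPolynomial.X 0 * MvPolynomial.pderiv 0 (MvPolynomial.X 1 * MvPolynomial.pderiv 1 Φ))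
            * (MvPolynomial.X 0 * MvPolynomial.pderiv 0 Φ) * (MvPolynomial.X 1 * MvPolynomial.pderiv 1 Φ)
          + MvPolynomial.X 1 * MvPolynomial.pderiv 1 (MvPolynomial.X 1 * MvPolynomial.pderiv 1 Φ)
            * (MvPolynomial.X 0 * MvPolynomial.pderiv 0 Φ) ^ 2) = 0 := by
  simp only [map_sub, map_add, map_mul, map_pow, Derivation.leibniz, smul_eq_mul, MvPolynomial.pderiv_X_self, h1, h11,
    mul_zero, zero_mul, add_zero, zero_pow two_ne_zero, sub_zero, mul_one]

/-! ### No fold, and simple branches -/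

/-- **Hyperbolic families never fold**: if `P t = Φ(t, ·)` splits over `ℝ` for all `t > 0` and `b₀` is an
EXACTLY double root of `P t₀` (`Φ = ∂_bΦ = 0 ≠ ∂_b²Φ` at `(t₀, b₀)`, `t₀ > 0`), then `∂_tΦ(t₀, b₀) = 0` — the point
is singular.  (Laguerre: `F(t) = ∂_bΦ(t,b₀)² − Φ(t,b₀)∂_b²Φ(t,b₀) ≥ 0` with `F(t₀) = 0`, so `F'(t₀) = 0`.) [folklore] -/
theorem no_fold_hyperbolic (Φ : MvPolynomial (Fin 2) ℝ) (P : ℝ → ℝ[X])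
    (hP : ∀ t b, (P t).eval b = MvPolynomial.eval ![t, b] Φ) (hsplit : ∀ t, 0 < t → (P t).Splits)
    {t₀ b₀ : ℝ} (ht₀ : 0 < t₀) (hΦ : MvPolynomial.eval ![t₀, b₀] Φ = 0)
    (hΦ1 : MvPolynomial.eval ![t₀, b₀] (pderiv 1 Φ) = 0)
    (hΦ11 : MvPolynomial.eval ![t₀, b₀] (pderiv 1 (pderiv 1 Φ)) ≠ 0) :
    MvPolynomial.eval ![t₀, b₀] (pderiv 0 Φ) = 0 := by
  set Ψ : MvPolynomial (Fin 2) ℝ := pderiv 1 Φ * pderiv 1 Φ - Φ * pderiv 1 (pderiv 1 Φ) with hΨ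
  -- `F(t) = Ψ(t, b₀) ≥ 0` for `t > 0`, `F(t₀) = 0`
  have hF : ∀ t, 0 < t → 0 ≤ MvPolynomial.eval ![t, b₀] Ψ := by
    intro t ht
    have hL := laguerre_nonneg (P t) (hsplit t ht) b₀
    simp only [hΨ, map_sub, map_mul, eval_pderiv_one_eq_derivative Φ P hP, eval_pderiv_one_one_eq Φ P hP, ← hP]
    nlinarith [hL]
  have hF0 : MvPolynomial.eval ![t₀, b₀] Ψ = 0 := by
    simp only [hΨ, map_sub, map_mul, hΦ, hΦ1, mul_zero, zero_mul, sub_zero]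
  have hmin : IsLocalMin (fun s => MvPolynomial.eval ![s, b₀] Ψ) t₀ := by
    refine Filter.eventually_of_mem (Ioi_mem_nhds ht₀) fun t ht => ?_
    show MvPolynomial.eval ![t₀, b₀] Ψ ≤ MvPolynomial.eval ![t, b₀] Ψ
    rw [hF0]
    exact hF t ht
  have hder := hmin.hasDerivAt_eq_zero (hasDerivAt_eval_horizontal Ψ t₀ b₀)
  have key : MvPolynomial.eval ![t₀, b₀] (pderiv 0 Ψ) =
      2 * MvPolynomial.eval ![t₀, b₀] (pderiv 1 Φ) * MvPolynomial.eval ![t₀, b₀] (pderiv 0 (pderiv 1 Φ))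
        - (MvPolynomial.eval ![t₀, b₀] Φ * MvPolynomial.eval ![t₀, b₀] (pderiv 0 (pderiv 1 (pderiv 1 Φ)))
          + MvPolynomial.eval ![t₀, b₀] (pderiv 1 (pderiv 1 Φ)) * MvPolynomial.eval ![t₀, b₀] (pderiv 0 Φ)) := by
    simp only [hΨ, Derivation.leibniz, smul_eq_mul, map_add, map_sub, map_mul]
    ring
  rw [hder, hΦ, hΦ1] at key
  have h0 : MvPolynomial.eval ![t₀, b₀] (pderiv 1 (pderiv 1 Φ)) * MvPolynomial.eval ![t₀, b₀] (pderiv 0 Φ) = 0 := by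
    linarith
  exact (mul_eq_zero.1 h0).resolve_left hΦ11

/-- **Simple branches.**  For a hyperbolic spectral curve in the line's general position «`∂_bΦ ≠ 0` on the
osculation set», every root `b₀ > 0` of `Φ(t₀, ·)` with `t₀ > 0` is SIMPLE: `rootMultiplicity ≤ 1`.  (A double
root is a singular point by `no_fold_hyperbolic`, a root of multiplicity `≥ 3` is a flex; either way `H(Φ) = 0`
there, so `(t₀, b₀)` is an osculation point with `∂_bΦ = 0`.) [folklore] -/
theorem rootMultiplicity_le_one_of_hyperbolic (Φ : MvPolynomial (Fin 2) ℝ) (P : ℝ → ℝ[X])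
    (hP : ∀ t b, (P t).eval b = MvPolynomial.eval ![t, b] Φ) (hsplit : ∀ t, 0 < t → (P t).Splits)
    (hgp : ∀ p ∈ {p : Fin 2 → ℝ | 0 < p 0 ∧ 0 < p 1 ∧ MvPolynomial.eval p Φ = 0 ∧
      MvPolynomial.eval p
        (MvPolynomial.X 0 * MvPolynomial.pderiv 0 (MvPolynomial.X 0 * MvPolynomial.pderiv 0 Φ)
            * (MvPolynomial.X 1 * MvPolynomial.pderiv 1 Φ) ^ 2
          - 2 * (MvPolynomial.X 0 * MvPolynomial.pderiv 0 (MvPolynomial.X 1 * MvPolynomial.pderiv 1 Φ))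
            * (MvPolynomial.X 0 * MvPolynomial.pderiv 0 Φ) * (MvPolynomial.X 1 * MvPolynomial.pderiv 1 Φ)
          + MvPolynomial.X 1 * MvPolynomial.pderiv 1 (MvPolynomial.X 1 * MvPolynomial.pderiv 1 Φ)
            * (MvPolynomial.X 0 * MvPolynomial.pderiv 0 Φ) ^ 2) = 0},
        MvPolynomial.eval p (MvPolynomial.pderiv 1 Φ) ≠ 0)
    {t₀ b₀ : ℝ} (ht₀ : 0 < t₀) (hb₀ : 0 < b₀) (hP0 : P t₀ ≠ 0) :
    (P t₀).rootMultiplicity b₀ ≤ 1 := by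
  by_contra hlt
  push Not at hlt
  have hroot : (P t₀).IsRoot b₀ := (rootMultiplicity_pos hP0).1 (by omega)
  have hder : (derivative (P t₀)).IsRoot b₀ :=
    isRoot_iterate_derivative_of_lt_rootMultiplicity (n := 1) hlt
  have hΦ : MvPolynomial.eval ![t₀, b₀] Φ = 0 := by rw [← hP]; exact hroot
  have hΦ1 : MvPolynomial.eval ![t₀, b₀] (pderiv 1 Φ) = 0 := by
    rw [eval_pderiv_one_eq_derivative Φ P hP]; exact hder
  have hH : MvPolynomial.eval ![t₀, b₀]
      (MvPolynomial.X 0 * MvPolynomial.pderiv 0 (MvPolynomial.X 0 * MvPolynomial.pderiv 0 Φ)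
          * (MvPolynomial.X 1 * MvPolynomial.pderiv 1 Φ) ^ 2
        - 2 * (MvPolynomial.X 0 * MvPolynomial.pderiv 0 (MvPolynomial.X 1 * MvPolynomial.pderiv 1 Φ))
          * (MvPolynomial.X 0 * MvPolynomial.pderiv 0 Φ) * (MvPolynomial.X 1 * MvPolynomial.pderiv 1 Φ)
        + MvPolynomial.X 1 * MvPolynomial.pderiv 1 (MvPolynomial.X 1 * MvPolynomial.pderiv 1 Φ)
          * (MvPolynomial.X 0 * MvPolynomial.pderiv 0 Φ) ^ 2) = 0 := by
    by_cases h11 : MvPolynomial.eval ![t₀, b₀] (pderiv 1 (pderiv 1 Φ)) = 0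
    · exact eval_logHessian_eq_zero_of_flex Φ _ hΦ1 h11
    · exact eval_logHessian_eq_zero_of_singular Φ _ (no_fold_hyperbolic Φ P hP hsplit ht₀ hΦ hΦ1 h11) hΦ1
  exact hgp ![t₀, b₀] ⟨by simpa using ht₀, by simpa using hb₀, hΦ, hH⟩ hΦ1

/-- **No vanishing fibre** (rank-free `not_finite_of_vertical_ray`): if `Φ(t₀, ·) ≡ 0` for some `t₀ > 0`, every
point `(t₀, b)`, `b > 0`, is an osculation point (`∂_bΦ ≡ ∂_b²Φ ≡ 0` on the line), so the osculation set is
infinite. [folklore] -/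
theorem not_finite_of_vanishing_fibre (Φ : MvPolynomial (Fin 2) ℝ) (P : ℝ → ℝ[X])
    (hP : ∀ t b, (P t).eval b = MvPolynomial.eval ![t, b] Φ) {t₀ : ℝ} (ht₀ : 0 < t₀) (h0 : P t₀ = 0) :
    ¬ {p : Fin 2 → ℝ | 0 < p 0 ∧ 0 < p 1 ∧ MvPolynomial.eval p Φ = 0 ∧
      MvPolynomial.eval p
        (MvPolynomial.X 0 * MvPolynomial.pderiv 0 (MvPolynomial.X 0 * MvPolynomial.pderiv 0 Φ)
            * (MvPolynomial.X 1 * MvPolynomial.pderiv 1 Φ) ^ 2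
          - 2 * (MvPolynomial.X 0 * MvPolynomial.pderiv 0 (MvPolynomial.X 1 * MvPolynomial.pderiv 1 Φ))
            * (MvPolynomial.X 0 * MvPolynomial.pderiv 0 Φ) * (MvPolynomial.X 1 * MvPolynomial.pderiv 1 Φ)
          + MvPolynomial.X 1 * MvPolynomial.pderiv 1 (MvPolynomial.X 1 * MvPolynomial.pderiv 1 Φ)
            * (MvPolynomial.X 0 * MvPolynomial.pderiv 0 Φ) ^ 2) = 0}.Finite := by
  intro hfin
  apply hfin.not_infinite
  refine Set.infinite_of_injOn_mapsTo (f := fun b : ℝ => (![t₀, b] : Fin 2 → ℝ)) ?_ ?_ (Set.Ioi_infinite 0)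
  · intro b _ b' _ hbb'
    have := congr_fun hbb' 1
    simpa [Matrix.cons_val_one] using this
  · intro b hb
    rw [Set.mem_Ioi] at hb
    have hΦb : MvPolynomial.eval ![t₀, b] (MvPolynomial.pderiv 1 Φ) = 0 := by
      rw [eval_pderiv_one_eq_derivative Φ P hP, h0, derivative_zero, eval_zero]
    have hΦbb : MvPolynomial.eval ![t₀, b] (MvPolynomial.pderiv 1 (MvPolynomial.pderiv 1 Φ)) = 0 := by
      rw [eval_pderiv_one_one_eq Φ P hP, h0, derivative_zero, derivative_zero, eval_zero]
    refine ⟨by simpa [Matrix.cons_val_zero] using ht₀, by simpa [Matrix.cons_val_one] using hb, ?_,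
      eval_logHessian_eq_zero_of_flex Φ _ hΦb hΦbb⟩
    rw [← hP, h0, eval_zero]

/-- **Simple branches, finite-osculation form**: with the osculation set finite (as in `PeelInequality`) the
non-vanishing of the fibre is automatic (`not_finite_of_vanishing_fibre`), so under general position EVERY root
`b₀ > 0` of `Φ(t₀, ·)`, `t₀ > 0`, of a hyperbolic family is simple. [folklore] -/
theorem rootMultiplicity_le_one_of_finite (Φ : MvPolynomial (Fin 2) ℝ) (P : ℝ → ℝ[X])
    (hP : ∀ t b, (P t).eval b = MvPolynomial.eval ![t, b] Φ) (hsplit : ∀ t, 0 < t → (P t).Splits)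
    (hfin : {p : Fin 2 → ℝ | 0 < p 0 ∧ 0 < p 1 ∧ MvPolynomial.eval p Φ = 0 ∧
      MvPolynomial.eval p
        (MvPolynomial.X 0 * MvPolynomial.pderiv 0 (MvPolynomial.X 0 * MvPolynomial.pderiv 0 Φ)
            * (MvPolynomial.X 1 * MvPolynomial.pderiv 1 Φ) ^ 2
          - 2 * (MvPolynomial.X 0 * MvPolynomial.pderiv 0 (MvPolynomial.X 1 * MvPolynomial.pderiv 1 Φ))
            * (MvPolynomial.X 0 * MvPolynomial.pderiv 0 Φ) * (MvPolynomial.X 1 * MvPolynomial.pderiv 1 Φ)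
          + MvPolynomial.X 1 * MvPolynomial.pderiv 1 (MvPolynomial.X 1 * MvPolynomial.pderiv 1 Φ)
            * (MvPolynomial.X 0 * MvPolynomial.pderiv 0 Φ) ^ 2) = 0}.Finite)
    (hgp : ∀ p ∈ {p : Fin 2 → ℝ | 0 < p 0 ∧ 0 < p 1 ∧ MvPolynomial.eval p Φ = 0 ∧
      MvPolynomial.eval p
        (MvPolynomial.X 0 * MvPolynomial.pderiv 0 (MvPolynomial.X 0 * MvPolynomial.pderiv 0 Φ)
            * (MvPolynomial.X 1 * MvPolynomial.pderiv 1 Φ) ^ 2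
          - 2 * (MvPolynomial.X 0 * MvPolynomial.pderiv 0 (MvPolynomial.X 1 * MvPolynomial.pderiv 1 Φ))
            * (MvPolynomial.X 0 * MvPolynomial.pderiv 0 Φ) * (MvPolynomial.X 1 * MvPolynomial.pderiv 1 Φ)
          + MvPolynomial.X 1 * MvPolynomial.pderiv 1 (MvPolynomial.X 1 * MvPolynomial.pderiv 1 Φ)
            * (MvPolynomial.X 0 * MvPolynomial.pderiv 0 Φ) ^ 2) = 0},
        MvPolynomial.eval p (MvPolynomial.pderiv 1 Φ) ≠ 0)
    {t₀ b₀ : ℝ} (ht₀ : 0 < t₀) (hb₀ : 0 < b₀) :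
    (P t₀).rootMultiplicity b₀ ≤ 1 :=
  rootMultiplicity_le_one_of_hyperbolic Φ P hP hsplit hgp ht₀ hb₀
    (fun h0 => not_finite_of_vanishing_fibre Φ P hP ht₀ h0 hfin)

end OsculationPeel

end Summit.ValiantsHypothesis.ValiantsHypothesis.Theorems.LacunarySymmetroidMatrixDescartes

end
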